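import Summits.SmoothPoincare4.SmoothPoincare4.Theorems.CylinderEntropyCylinderRungTwoKillingFluxDefs
import Summits.SmoothPoincare4.SmoothPoincare4.Theorems.CylinderEntropyCylinderRungTwoAreaDissipation
import Summits.SmoothPoincare4.SmoothPoincare4.Theorems.CylinderEntropyCylinderRungTwoHamiltonMonotonicityTransport
import Summits.SmoothPoincare4.SmoothPoincare4.Theorems.CylinderEntropyCylinderRungTwoHamiltonMonotonicityDensity
import Mathlib.MeasureTheory.Integral.IntervalIntegral.FundThmCalculus
import HarnessLib

/-!
# Route `CylinderEntropy`, crux `CylinderRungTwo` (stmt-SmoothPoincare4-7631), line `killing-flux`: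
# the parabolic DISSIPATION BUDGET (registered stub `stub_dissipationBudget`, lead reshape r7)

Along a smooth mean curvature flow `IsCylinderMCF M F ν T`
(`CylinderEntropyCylinderRungTwoKillingFluxDefs.lean`) of closed embedded cross-sections of
`N = S⁴ × ℝ ⊂ ℝ⁶`, for every `t ≥ T`,

  `∫_{r ∈ [T, t]} (∫_M ‖∂_r F(r, x)‖² d((F r)^* μH⁴)(x)) dr + μH⁴(F_t(M)) ≤ μH⁴(F_T(M))`

— classically the EQUALITY `Area(M_T) - Area(M_t) = ∫_T^t ∫_{M_r} H² dμ_r dr` (Huisken 1984, §3;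
Brakke: the area is a Lyapunov function of the flow), with `‖∂_r F‖ = |H|` (`∂_r F = -H ν`, `‖ν‖ = 1`).

Proof (no Tonelli, no differentiation of `H`): write every area measure against the fixed one,
`dμ_r = θ_r dμ_T` with `θ_r = √D_r/√D_T` the ratio of the coordinate-frame Gram determinants
(landed `IsCylinderMCF.integral_riemannianMeasure_eq`, `…riemannianMeasure_univ_eq_lintegral`).

* `A(r) = ∫_M θ_r dμ_T = μ_r(M)` is continuous on `[T, ∞)` (right-continuity at `T`: landed
  `IsCylinderMCF.continuousWithinAt_integral_mul_density`) and differentiable on `(T, ∞)` with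
  `A'(r) = -∫_M ‖∂_r F‖² θ_r dμ_T = -∫_{M} ‖∂_r F‖² dμ_r` (landed transport formula
  `IsCylinderMCF.hasDerivAt_integral_mul_density` with `f ≡ 1`, and `‖∂_r F‖² = H²`,
  `IsCylinderMCF.norm_deriv_sq_eq`);
* the derivative of the monotone `-A` is automatically integrable
  (`intervalIntegral.integrableOn_deriv_of_nonneg`) and FTC-2 for right derivatives
  (`intervalIntegral.integral_eq_sub_of_hasDeriv_right_of_le`) gives
  `∫_T^t ∫_M ‖∂_r F‖² dμ_r dr = A(T) - A(t)`;
* the area formula `μHE⁴(F_r(M)) = μ_r(M)` (`IsCylinderMCF.euclideanHausdorffMeasure_range_eq`),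
  `(F r)^* μHE⁴ = μ_r` on integrands (`lintegral_comp_riemannianMeasure_induced` through
  `MeasurableEmbedding.map_comap`) and `μHE⁴ = c • μH⁴` (`exists_euclideanHausdorff_six_eq_smul`)
  translate this real identity into the registered `ℝ≥0∞` inequality (with equality).

Everything here is PROVED (no `sorry`, no new definitions, no named facts).

References: G. Huisken, *Flow by mean curvature of convex surfaces into spheres*, J. Differential
Geom. 20 (1984), §3; C. Mantegazza, *Lecture Notes on Mean Curvature Flow* (2011), Prop. 2.3.3 and
Cor. 2.3.4; H. Federer, *Geometric Measure Theory* (1969), 3.2.3 and 3.2.46.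
-/

-- the prescribed namespace `Summit.SmoothPoincare4.SmoothPoincare4.…` repeats `SmoothPoincare4`
set_option linter.dupNamespace false

noncomputable section

open Bundle MeasureTheory Set Function Filter Module
open scoped Manifold ContDiff ENNReal Topology RealInnerProductSpace NNReal Matrix

namespace Summit.SmoothPoincare4.SmoothPoincare4.Cruxes.CylinderRungTwo.KillingFlux

open Literature.Geometry.Riemannian Literature.Geometry.Riemannian.EuclideanHypersurface
open Literature.Geometry.Lorentzian Literature.Geometry.Lorentzian.PseudoRiemannianMetric
open Literature.Analysis.Calculus

section Budget

variable {M : Type} [TopologicalSpace M] [ChartedSpace (EuclideanSpace ℝ (Fin 4)) M]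
  [IsManifold (𝓡 4) ∞ M] {F ν : ℝ → M → EuclideanSpace ℝ (Fin 6)} {T : ℝ}

/-- The speed `w ↦ ∂_s F(s, w)` of a cylinder flow is continuous on each slice `s ≥ T` (joint
continuity of the time derivative, tree `continuousOn_timeDeriv`). [folklore] -/
theorem IsCylinderMCF.continuous_deriv_slice (h : IsCylinderMCF M F ν T) {s : ℝ} (hs : T ≤ s) :
    Continuous fun w => deriv (fun s' => F s' w) s := by
  obtain ⟨U, hU, hIU, hFj⟩ := h.contMDiffOn
  exact (continuousOn_timeDeriv hU hFj).comp_continuous (continuous_const.prodMk continuous_id)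
    fun w => ⟨hIU (mem_Ici.2 hs), mem_univ _⟩

variable [T2Space M] [CompactSpace M] [MeasurableSpace M] [BorelSpace M]

/-- **`(F s)^* μH⁴` versus the area measure**: for `s ≥ T` and `μHE⁴ = c • μH⁴`,
`c · ∫⁻ φ d((F s)^* μH⁴) = ∫⁻ φ dμ_s` for every `φ : M → ℝ≥0∞`, `μ_s` the Riemannian measure of
`F_s^*δ` (`F s` is a closed measurable embedding: `MeasurableEmbedding.map_comap` and the area
formula `lintegral_comp_riemannianMeasure_induced`). [cite: Federer1969, 3.2.3 and 3.2.46] -/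
theorem IsCylinderMCF.mul_lintegral_comap_eq (h : IsCylinderMCF M F ν T) {s : ℝ} (hs : T ≤ s)
    {c : ℝ≥0} (hc : (μHE[4] : Measure (EuclideanSpace ℝ (Fin 6))) =
      c • (μH[4] : Measure (EuclideanSpace ℝ (Fin 6)))) (φ : M → ℝ≥0∞) :
    (c : ℝ≥0∞) * ∫⁻ x, φ x ∂(Measure.comap (F s) (μH[4] : Measure (EuclideanSpace ℝ (Fin 6)))) =
      ∫⁻ w, φ w ∂riemannianMeasure ((euclideanMetric (EuclideanSpace ℝ (Fin 6))).inducedRiemannianMetric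
        (F s) contMDiff_pullbackBilin_holds (h.isSpacelikeImmersion s hs)) := by
  have hme : MeasurableEmbedding (F s) :=
    ((h.isSpacelikeImmersion s hs).contMDiff.continuous.isClosedEmbedding
      (h.injective hs)).measurableEmbedding
  have hext : ∀ x, φ x = Function.extend (F s) φ 0 (F s x) := fun x =>
    ((h.injective hs).extend_apply φ 0 x).symm
  have h1 : ∫⁻ x, φ x ∂(Measure.comap (F s) (μH[4] : Measure (EuclideanSpace ℝ (Fin 6)))) =
      ∫⁻ z in range (F s), Function.extend (F s) φ 0 z ∂μH[4] := by
    rw [← hme.map_comap, hme.lintegral_map]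
    exact lintegral_congr fun x => hext x
  rw [h1, h.mul_setLIntegral_range_eq hs hc]
  exact lintegral_congr fun x => (hext x).symm

/-- **`μ_r(M) = ∫ θ dμ_{t₀}`** as a Bochner integral: for `r, t₀ ≥ T`,
`∫_M 1 · (√D_r/√D_{t₀}) dμ_{t₀} = μ_r(M)` (real numbers), `D` the coordinate-frame Gram
determinants (landed `IsCylinderMCF.integral_riemannianMeasure_eq` with `φ ≡ 1`).
[cite: Mantegazza2011, Prop. 2.3.3] -/
theorem IsCylinderMCF.integral_one_mul_density_eq (h : IsCylinderMCF M F ν T) {r t₀ : ℝ}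
    (hr : T ≤ r) (ht₀ : T ≤ t₀) :
    ∫ w, (1 : ℝ) * (Real.sqrt (Matrix.of fun i j =>
          (euclideanMetric (EuclideanSpace ℝ (Fin 6))).inducedBilin (𝓡 4) (F r) w
            ((trivializationAt (EuclideanSpace ℝ (Fin 4)) (TangentSpace (𝓡 4)) w).localFrame
              (EuclideanSpace.basisFun (Fin 4) ℝ).toBasis i w)
            ((trivializationAt (EuclideanSpace ℝ (Fin 4)) (TangentSpace (𝓡 4)) w).localFrame
              (EuclideanSpace.basisFun (Fin 4) ℝ).toBasis j w)).det /
         Real.sqrt (Matrix.of fun i j =>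
          (euclideanMetric (EuclideanSpace ℝ (Fin 6))).inducedBilin (𝓡 4) (F t₀) w
            ((trivializationAt (EuclideanSpace ℝ (Fin 4)) (TangentSpace (𝓡 4)) w).localFrame
              (EuclideanSpace.basisFun (Fin 4) ℝ).toBasis i w)
            ((trivializationAt (EuclideanSpace ℝ (Fin 4)) (TangentSpace (𝓡 4)) w).localFrame
              (EuclideanSpace.basisFun (Fin 4) ℝ).toBasis j w)).det)
        ∂riemannianMeasure ((euclideanMetric (EuclideanSpace ℝ (Fin 6))).inducedRiemannianMetric
          (F t₀) contMDiff_pullbackBilin_holds (h.isSpacelikeImmersion t₀ ht₀)) =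
      (riemannianMeasure ((euclideanMetric (EuclideanSpace ℝ (Fin 6))).inducedRiemannianMetric
          (F r) contMDiff_pullbackBilin_holds (h.isSpacelikeImmersion r hr)) univ).toReal := by
  have h1 := h.integral_riemannianMeasure_eq hr ht₀ (fun _ => (1 : ℝ))
  rw [integral_const, smul_eq_mul, mul_one, measureReal_def] at h1
  rw [h1]
  refine integral_congr_ae (Eventually.of_forall fun w => ?_)
  simp only [smul_eq_mul, one_mul, mul_one]

/-- **`d/dr μ_r(M) = -∫_M ‖∂_r F‖² dμ_r` on `(T, ∞)`**, with both sides written against the fixed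
measure `μ_T`: `A(r) = ∫_M 1 · θ_r dμ_T` has derivative `-∫_M ‖∂_r F(r, w)‖² θ_r(w) dμ_T(w)` at every
`r > T`, `θ_r = √D_r/√D_T` (landed transport formula `IsCylinderMCF.hasDerivAt_integral_mul_density`
with `f ≡ 1`, `‖∂_r F‖² = H²`, and `∫ φ dμ_r = ∫ θ_r φ dμ_T` to change the reference time).
[cite: Huisken1984, §3] [cite: Mantegazza2011, Prop. 2.3.3] -/
theorem IsCylinderMCF.hasDerivAt_integral_density (h : IsCylinderMCF M F ν T) {s : ℝ} (hTs : T < s) :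
    HasDerivAt (fun r => ∫ w, (1 : ℝ) * (Real.sqrt (Matrix.of fun i j =>
          (euclideanMetric (EuclideanSpace ℝ (Fin 6))).inducedBilin (𝓡 4) (F r) w
            ((trivializationAt (EuclideanSpace ℝ (Fin 4)) (TangentSpace (𝓡 4)) w).localFrame
              (EuclideanSpace.basisFun (Fin 4) ℝ).toBasis i w)
            ((trivializationAt (EuclideanSpace ℝ (Fin 4)) (TangentSpace (𝓡 4)) w).localFrame
              (EuclideanSpace.basisFun (Fin 4) ℝ).toBasis j w)).det /
         Real.sqrt (Matrix.of fun i j =>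
          (euclideanMetric (EuclideanSpace ℝ (Fin 6))).inducedBilin (𝓡 4) (F T) w
            ((trivializationAt (EuclideanSpace ℝ (Fin 4)) (TangentSpace (𝓡 4)) w).localFrame
              (EuclideanSpace.basisFun (Fin 4) ℝ).toBasis i w)
            ((trivializationAt (EuclideanSpace ℝ (Fin 4)) (TangentSpace (𝓡 4)) w).localFrame
              (EuclideanSpace.basisFun (Fin 4) ℝ).toBasis j w)).det)
        ∂riemannianMeasure ((euclideanMetric (EuclideanSpace ℝ (Fin 6))).inducedRiemannianMetric
          (F T) contMDiff_pullbackBilin_holds (h.isSpacelikeImmersion T le_rfl)))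
      (-∫ w, ‖deriv (fun s' => F s' w) s‖ ^ 2 * (Real.sqrt (Matrix.of fun i j =>
          (euclideanMetric (EuclideanSpace ℝ (Fin 6))).inducedBilin (𝓡 4) (F s) w
            ((trivializationAt (EuclideanSpace ℝ (Fin 4)) (TangentSpace (𝓡 4)) w).localFrame
              (EuclideanSpace.basisFun (Fin 4) ℝ).toBasis i w)
            ((trivializationAt (EuclideanSpace ℝ (Fin 4)) (TangentSpace (𝓡 4)) w).localFrame
              (EuclideanSpace.basisFun (Fin 4) ℝ).toBasis j w)).det /
         Real.sqrt (Matrix.of fun i j =>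
          (euclideanMetric (EuclideanSpace ℝ (Fin 6))).inducedBilin (𝓡 4) (F T) w
            ((trivializationAt (EuclideanSpace ℝ (Fin 4)) (TangentSpace (𝓡 4)) w).localFrame
              (EuclideanSpace.basisFun (Fin 4) ℝ).toBasis i w)
            ((trivializationAt (EuclideanSpace ℝ (Fin 4)) (TangentSpace (𝓡 4)) w).localFrame
              (EuclideanSpace.basisFun (Fin 4) ℝ).toBasis j w)).det)
        ∂riemannianMeasure ((euclideanMetric (EuclideanSpace ℝ (Fin 6))).inducedRiemannianMetric
          (F T) contMDiff_pullbackBilin_holds (h.isSpacelikeImmersion T le_rfl))) s := by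
  -- the transport formula at `s`, reference measure `μ_s`, `f ≡ 1`
  have hTa : T ≤ (T + s) / 2 := by linarith
  have hsI : s ∈ Ioo ((T + s) / 2) (s + 1) := ⟨by linarith, by linarith⟩
  have hmain := h.hasDerivAt_integral_mul_density hTa hsI (f := fun _ _ => (1 : ℝ))
    (f' := fun _ _ => (0 : ℝ)) continuousOn_const continuousOn_const
    (fun r _ w => hasDerivAt_const r (1 : ℝ))
  refine (hmain.congr_of_eventuallyEq ?_).congr_deriv ?_
  · -- near `s` both functions are `r ↦ μ_r(M)`
    filter_upwards [Ici_mem_nhds hTs] with r hr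
    exact (h.integral_one_mul_density_eq hr le_rfl).trans
      (h.integral_one_mul_density_eq hr hTs.le).symm
  · rw [h.integral_riemannianMeasure_eq hTs.le le_rfl, ← integral_neg]
    refine integral_congr_ae (Eventually.of_forall fun w => ?_)
    simp only [smul_eq_mul]
    rw [h.norm_deriv_sq_eq hTs.le w]
    ring

/-- **`r ↦ μ_r(M) = ∫_M 1 · θ_r dμ_T` is continuous on `[T, ∞)`**: right-continuous at `T` (landed
`IsCylinderMCF.continuousWithinAt_integral_mul_density`, dominated convergence) and differentiable
at every `r > T` (`IsCylinderMCF.hasDerivAt_integral_density`). [cite: Mantegazza2011, Prop. 2.3.3] -/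
theorem IsCylinderMCF.continuousOn_integral_density (h : IsCylinderMCF M F ν T) :
    ContinuousOn (fun r => ∫ w, (1 : ℝ) * (Real.sqrt (Matrix.of fun i j =>
          (euclideanMetric (EuclideanSpace ℝ (Fin 6))).inducedBilin (𝓡 4) (F r) w
            ((trivializationAt (EuclideanSpace ℝ (Fin 4)) (TangentSpace (𝓡 4)) w).localFrame
              (EuclideanSpace.basisFun (Fin 4) ℝ).toBasis i w)
            ((trivializationAt (EuclideanSpace ℝ (Fin 4)) (TangentSpace (𝓡 4)) w).localFrame
              (EuclideanSpace.basisFun (Fin 4) ℝ).toBasis j w)).det /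
         Real.sqrt (Matrix.of fun i j =>
          (euclideanMetric (EuclideanSpace ℝ (Fin 6))).inducedBilin (𝓡 4) (F T) w
            ((trivializationAt (EuclideanSpace ℝ (Fin 4)) (TangentSpace (𝓡 4)) w).localFrame
              (EuclideanSpace.basisFun (Fin 4) ℝ).toBasis i w)
            ((trivializationAt (EuclideanSpace ℝ (Fin 4)) (TangentSpace (𝓡 4)) w).localFrame
              (EuclideanSpace.basisFun (Fin 4) ℝ).toBasis j w)).det)
        ∂riemannianMeasure ((euclideanMetric (EuclideanSpace ℝ (Fin 6))).inducedRiemannianMetric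
          (F T) contMDiff_pullbackBilin_holds (h.isSpacelikeImmersion T le_rfl))) (Ici T) := by
  intro s hs
  rcases eq_or_lt_of_le (mem_Ici.1 hs) with h0 | h0
  · subst h0
    exact h.continuousWithinAt_integral_mul_density (lt_add_one T) (f := fun _ _ => (1 : ℝ))
      continuousOn_const
  · exact (h.hasDerivAt_integral_density h0).continuousAt.continuousWithinAt

/-- **The inner integral of the budget**: for `r ≥ T` and `μHE⁴ = c • μH⁴`,
`∫⁻_M ‖∂_r F(r, x)‖² d((F r)^* μH⁴)(x) = c⁻¹ · ∫_M ‖∂_r F(r, w)‖² θ_r(w) dμ_T(w)` (the speed is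
continuous on the compact slice, so the `ℝ≥0∞`-integral against the finite area measure is a
Bochner integral; `dμ_r = θ_r dμ_T`). [cite: Federer1969, 3.2.3 and 3.2.46] -/
theorem IsCylinderMCF.lintegral_comap_normSq_deriv_eq (h : IsCylinderMCF M F ν T) {s : ℝ}
    (hs : T ≤ s) {c : ℝ≥0} (hc0 : c ≠ 0) (hc : (μHE[4] : Measure (EuclideanSpace ℝ (Fin 6))) =
      c • (μH[4] : Measure (EuclideanSpace ℝ (Fin 6)))) :
    ∫⁻ x, ENNReal.ofReal (‖deriv (fun s' => F s' x) s‖ ^ 2)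
        ∂(Measure.comap (F s) (μH[4] : Measure (EuclideanSpace ℝ (Fin 6)))) =
      (c : ℝ≥0∞)⁻¹ * ENNReal.ofReal (∫ w, ‖deriv (fun s' => F s' w) s‖ ^ 2 *
        (Real.sqrt (Matrix.of fun i j =>
          (euclideanMetric (EuclideanSpace ℝ (Fin 6))).inducedBilin (𝓡 4) (F s) w
            ((trivializationAt (EuclideanSpace ℝ (Fin 4)) (TangentSpace (𝓡 4)) w).localFrame
              (EuclideanSpace.basisFun (Fin 4) ℝ).toBasis i w)
            ((trivializationAt (EuclideanSpace ℝ (Fin 4)) (TangentSpace (𝓡 4)) w).localFrame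
              (EuclideanSpace.basisFun (Fin 4) ℝ).toBasis j w)).det /
         Real.sqrt (Matrix.of fun i j =>
          (euclideanMetric (EuclideanSpace ℝ (Fin 6))).inducedBilin (𝓡 4) (F T) w
            ((trivializationAt (EuclideanSpace ℝ (Fin 4)) (TangentSpace (𝓡 4)) w).localFrame
              (EuclideanSpace.basisFun (Fin 4) ℝ).toBasis i w)
            ((trivializationAt (EuclideanSpace ℝ (Fin 4)) (TangentSpace (𝓡 4)) w).localFrame
              (EuclideanSpace.basisFun (Fin 4) ℝ).toBasis j w)).det)
        ∂riemannianMeasure ((euclideanMetric (EuclideanSpace ℝ (Fin 6))).inducedRiemannianMetric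
          (F T) contMDiff_pullbackBilin_holds (h.isSpacelikeImmersion T le_rfl))) := by
  have hc0' : (c : ℝ≥0∞) ≠ 0 := ENNReal.coe_ne_zero.2 hc0
  have hcont : Continuous fun w => ‖deriv (fun s' => F s' w) s‖ ^ 2 :=
    (h.continuous_deriv_slice hs).norm.pow 2
  have hint : Integrable (fun w => ‖deriv (fun s' => F s' w) s‖ ^ 2)
      (riemannianMeasure ((euclideanMetric (EuclideanSpace ℝ (Fin 6))).inducedRiemannianMetric
        (F s) contMDiff_pullbackBilin_holds (h.isSpacelikeImmersion s hs))) :=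
    integrable_of_continuous (h := (euclideanMetric (EuclideanSpace ℝ (Fin 6))).inducedRiemannianMetric
        (F s) contMDiff_pullbackBilin_holds (h.isSpacelikeImmersion s hs)) hcont
  have h1 := h.mul_lintegral_comap_eq hs hc (fun x => ENNReal.ofReal (‖deriv (fun s' => F s' x) s‖ ^ 2))
  rw [← ofReal_integral_eq_lintegral_ofReal hint (Eventually.of_forall fun w => by positivity),
    h.integral_riemannianMeasure_eq hs le_rfl] at h1
  calc ∫⁻ x, ENNReal.ofReal (‖deriv (fun s' => F s' x) s‖ ^ 2)
        ∂(Measure.comap (F s) (μH[4] : Measure (EuclideanSpace ℝ (Fin 6))))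
      = (c : ℝ≥0∞)⁻¹ * ((c : ℝ≥0∞) * ∫⁻ x, ENNReal.ofReal (‖deriv (fun s' => F s' x) s‖ ^ 2)
          ∂(Measure.comap (F s) (μH[4] : Measure (EuclideanSpace ℝ (Fin 6))))) := by
        rw [← mul_assoc, ENNReal.inv_mul_cancel hc0' ENNReal.coe_ne_top, one_mul]
    _ = _ := by
        rw [h1]
        congr 2
        refine integral_congr_ae (Eventually.of_forall fun w => ?_)
        simp only [smul_eq_mul]
        ring

/-- **The dissipation budget along a smooth cylinder flow** (with equality, classically
`Area(M_T) - Area(M_t) = ∫_T^t ∫ H² dμ_r dr`): for `t ≥ T`,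
`∫⁻_{[T,t]} ∫⁻_M ‖∂_r F‖² d((F r)^* μH⁴) dr + μH⁴(F_t(M)) ≤ μH⁴(F_T(M))`. See the module docstring
for the proof (transport formula with `f ≡ 1`, FTC-2 for the monotone area, area formula).
[cite: Huisken1984, §3] [cite: Mantegazza2011, Prop. 2.3.3] -/
theorem IsCylinderMCF.dissipationBudget (h : IsCylinderMCF M F ν T) {t : ℝ} (ht : T ≤ t) :
    (∫⁻ r in Icc T t, ∫⁻ x, ENNReal.ofReal (‖deriv (fun s => F s x) r‖ ^ 2)
        ∂(Measure.comap (F r) (μH[4] : Measure (EuclideanSpace ℝ (Fin 6))))) +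
      μH[4] (range (F t)) ≤ μH[4] (range (F T)) := by
  obtain ⟨c, hc0, hHE⟩ := exists_euclideanHausdorff_six_eq_smul
  have hc0' : (c : ℝ≥0∞) ≠ 0 := ENNReal.coe_ne_zero.2 hc0
  -- the area `A r = μ_r(M)` and the dissipation `Φ r = ∫ ‖∂_r F‖² dμ_r`, written against `μ_T`
  set A : ℝ → ℝ := fun r => ∫ w, (1 : ℝ) * (Real.sqrt (Matrix.of fun i j =>
          (euclideanMetric (EuclideanSpace ℝ (Fin 6))).inducedBilin (𝓡 4) (F r) w
            ((trivializationAt (EuclideanSpace ℝ (Fin 4)) (TangentSpace (𝓡 4)) w).localFrame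
              (EuclideanSpace.basisFun (Fin 4) ℝ).toBasis i w)
            ((trivializationAt (EuclideanSpace ℝ (Fin 4)) (TangentSpace (𝓡 4)) w).localFrame
              (EuclideanSpace.basisFun (Fin 4) ℝ).toBasis j w)).det /
         Real.sqrt (Matrix.of fun i j =>
          (euclideanMetric (EuclideanSpace ℝ (Fin 6))).inducedBilin (𝓡 4) (F T) w
            ((trivializationAt (EuclideanSpace ℝ (Fin 4)) (TangentSpace (𝓡 4)) w).localFrame
              (EuclideanSpace.basisFun (Fin 4) ℝ).toBasis i w)
            ((trivializationAt (EuclideanSpace ℝ (Fin 4)) (TangentSpace (𝓡 4)) w).localFrame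
              (EuclideanSpace.basisFun (Fin 4) ℝ).toBasis j w)).det)
        ∂riemannianMeasure ((euclideanMetric (EuclideanSpace ℝ (Fin 6))).inducedRiemannianMetric
          (F T) contMDiff_pullbackBilin_holds (h.isSpacelikeImmersion T le_rfl))
  set Φ : ℝ → ℝ := fun r => ∫ w, ‖deriv (fun s' => F s' w) r‖ ^ 2 * (Real.sqrt (Matrix.of fun i j =>
          (euclideanMetric (EuclideanSpace ℝ (Fin 6))).inducedBilin (𝓡 4) (F r) w
            ((trivializationAt (EuclideanSpace ℝ (Fin 4)) (TangentSpace (𝓡 4)) w).localFrame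
              (EuclideanSpace.basisFun (Fin 4) ℝ).toBasis i w)
            ((trivializationAt (EuclideanSpace ℝ (Fin 4)) (TangentSpace (𝓡 4)) w).localFrame
              (EuclideanSpace.basisFun (Fin 4) ℝ).toBasis j w)).det /
         Real.sqrt (Matrix.of fun i j =>
          (euclideanMetric (EuclideanSpace ℝ (Fin 6))).inducedBilin (𝓡 4) (F T) w
            ((trivializationAt (EuclideanSpace ℝ (Fin 4)) (TangentSpace (𝓡 4)) w).localFrame
              (EuclideanSpace.basisFun (Fin 4) ℝ).toBasis i w)
            ((trivializationAt (EuclideanSpace ℝ (Fin 4)) (TangentSpace (𝓡 4)) w).localFrame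
              (EuclideanSpace.basisFun (Fin 4) ℝ).toBasis j w)).det)
        ∂riemannianMeasure ((euclideanMetric (EuclideanSpace ℝ (Fin 6))).inducedRiemannianMetric
          (F T) contMDiff_pullbackBilin_holds (h.isSpacelikeImmersion T le_rfl))
  have hAeq : ∀ r (hr : T ≤ r), A r = (riemannianMeasure ((euclideanMetric
      (EuclideanSpace ℝ (Fin 6))).inducedRiemannianMetric (F r) contMDiff_pullbackBilin_holds
        (h.isSpacelikeImmersion r hr)) univ).toReal := fun r hr =>
    h.integral_one_mul_density_eq hr le_rfl
  have hAd : ∀ r, T < r → HasDerivAt A (-Φ r) r := fun r hr => h.hasDerivAt_integral_density hr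
  have hAc : ContinuousOn A (Icc T t) := h.continuousOn_integral_density.mono Icc_subset_Ici_self
  have hΦ0 : ∀ r, 0 ≤ Φ r := fun r => integral_nonneg fun w =>
    mul_nonneg (sq_nonneg _) (div_nonneg (Real.sqrt_nonneg _) (Real.sqrt_nonneg _))
  have hA0 : ∀ r, T ≤ r → 0 ≤ A r := fun r hr => by
    rw [hAeq r hr]; exact ENNReal.toReal_nonneg
  -- FTC-2 for the monotone `-A` on `[T, t]`
  have hAd' : ∀ r ∈ Ioo T t, HasDerivAt (fun r => -A r) (Φ r) r := fun r hr =>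
    (hAd r hr.1).neg.congr_deriv (neg_neg _)
  have hintIoc : IntegrableOn Φ (Ioc T t) :=
    intervalIntegral.integrableOn_deriv_of_nonneg hAc.neg hAd' fun r _ => hΦ0 r
  have hFTC : ∫ r in T..t, Φ r = A T - A t := by
    rw [intervalIntegral.integral_eq_sub_of_hasDeriv_right_of_le ht hAc.neg
      (fun r hr => (hAd' r hr).hasDerivWithinAt)
      ((intervalIntegrable_iff_integrableOn_Ioc_of_le ht).2 hintIoc)]
    simp only [Pi.neg_apply]
    ring
  have hsub0 : 0 ≤ A T - A t := by
    rw [← hFTC]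
    exact intervalIntegral.integral_nonneg ht fun r _ => hΦ0 r
  -- the inner integrals and the areas in terms of `Φ` and `A`
  have hinner : ∀ r, T ≤ r → ∫⁻ x, ENNReal.ofReal (‖deriv (fun s => F s x) r‖ ^ 2)
      ∂(Measure.comap (F r) (μH[4] : Measure (EuclideanSpace ℝ (Fin 6)))) =
        (c : ℝ≥0∞)⁻¹ * ENNReal.ofReal (Φ r) := fun r hr =>
    h.lintegral_comap_normSq_deriv_eq hr hc0 hHE
  have harea : ∀ r, T ≤ r → μH[4] (range (F r)) = (c : ℝ≥0∞)⁻¹ * ENNReal.ofReal (A r) := by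
    intro r hr
    haveI := isFiniteMeasure_riemannianMeasure ((euclideanMetric
      (EuclideanSpace ℝ (Fin 6))).inducedRiemannianMetric (F r) contMDiff_pullbackBilin_holds
        (h.isSpacelikeImmersion r hr))
    rw [hAeq r hr, ENNReal.ofReal_toReal (measure_ne_top _ _),
      ← h.euclideanHausdorffMeasure_range_eq hr, hHE, Measure.coe_nnreal_smul_apply, ← mul_assoc,
      ENNReal.inv_mul_cancel hc0' ENNReal.coe_ne_top, one_mul]
  -- assembly
  have hL : (∫⁻ r in Icc T t, ∫⁻ x, ENNReal.ofReal (‖deriv (fun s => F s x) r‖ ^ 2)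
      ∂(Measure.comap (F r) (μH[4] : Measure (EuclideanSpace ℝ (Fin 6))))) =
        (c : ℝ≥0∞)⁻¹ * ENNReal.ofReal (A T - A t) := by
    rw [setLIntegral_congr_fun measurableSet_Icc (fun r hr => hinner r hr.1),
      lintegral_const_mul' _ _ (ENNReal.inv_ne_top.2 hc0'), setLIntegral_congr Ioc_ae_eq_Icc.symm,
      ← ofReal_integral_eq_lintegral_ofReal hintIoc (Eventually.of_forall fun r => hΦ0 r),
      ← intervalIntegral.integral_of_le ht, hFTC]
  rw [hL, harea t ht, harea T le_rfl, ← mul_add, ← ENNReal.ofReal_add hsub0 (hA0 t ht),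
    sub_add_cancel]

end Budget

/-- **Registered stub `stub_dissipationBudget` (line `killing-flux`, crux
`CylinderEntropy.CylinderRungTwo`, stmt-SmoothPoincare4-7631; lead reshape r7): the parabolic
DISSIPATION BUDGET.** Along a smooth mean curvature flow `IsCylinderMCF M F ν T` of closed embedded
cross-sections of `N = S⁴ × ℝ ⊂ ℝ⁶`, for every `t ≥ T`,
`∫⁻_{r ∈ [T, t]} ∫⁻_M ‖∂_r F(r, x)‖² d((F r)^* μH⁴)(x) dr + μH⁴(F_t(M)) ≤ μH⁴(F_T(M))`
(`IsCylinderMCF.dissipationBudget`; classically the equality `d/dt Area = -∫ H²`, `‖∂_r F‖ = |H|`).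
[cite: Huisken1984, §3] [cite: Mantegazza2011, Prop. 2.3.3] -/
theorem stub_dissipationBudget :
    ∀ (M : Type) [TopologicalSpace M] [T2Space M] [SecondCountableTopology M]
      [ChartedSpace (EuclideanSpace ℝ (Fin 4)) M] [IsManifold (𝓡 4) ∞ M] [CompactSpace M]
      [MeasurableSpace M] [BorelSpace M]
      (F : ℝ → M → EuclideanSpace ℝ (Fin 6)) (ν : ℝ → M → EuclideanSpace ℝ (Fin 6)) (T : ℝ),
      IsCylinderMCF M F ν T →
      ∀ t, T ≤ t →
        (∫⁻ r in Set.Icc T t, ∫⁻ x, ENNReal.ofReal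
            (‖deriv (fun s => F s x) r‖ ^ 2)
            ∂(Measure.comap (F r) (μH[4] : Measure (EuclideanSpace ℝ (Fin 6))))) +
          μH[4] (Set.range (F t)) ≤ μH[4] (Set.range (F T)) :=
  fun _ _ _ _ _ _ _ _ _ _ _ _ h _ ht => h.dissipationBudget ht

end Summit.SmoothPoincare4.SmoothPoincare4.Cruxes.CylinderRungTwo.KillingFlux

end
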